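import Summits.AtomisticToContinuum.Crystallization.Theorems.FrustratedLawDichotomyExemptSplit

/-!
# FrustratedLawDichotomy · crux `AperiodicFrustratedLawGap` (stmt-AtomisticToContinuum-27623) — MOTIF-LOCAL EXEMPTION TESTS
# (the exchange / removal exemptions read only the atoms within `Rm` of the site, at the price of a far-field slack)
# (decomp-a2c, prover hand 2, structural share, generation 14; generic, radius-free)

The exemptions of `…ExemptLocOpt` / `…ExemptRemoval` (`ExchangeUnstable ε ϱ K`, `RemovalUnstable eUp t`) are stated with the fields of the
WHOLE finite cluster `y`.  A certificate (or the census) sees a MOTIF: the atoms within some radius `Rm` of the site.  Since `V_LJ` beyond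
distance `D ≥ 7/10` contributes at most `T(D)` per point to any field over a `7/10`-separated set (`abs_tsum_field_le_of_far`), the local
tests below — which sum the fields only over the atoms of `y` within `Rm` of `y_j` — IMPLY the cluster-level exemptions with a slack, hence
are deep-absent themselves (`DeepAbsent.of_imp`), hence FREE in every exempt price:

* `ExchangeUnstableLoc ε ϱ Rm K y j` : `Sep y` and some `s ⊆ y ∩ B̄(y_j, ϱ)`, `#s ≤ K`, and injective `R` in `B̄(y_j, ϱ)` of the same size avoiding
  `y ∖ s`, with `U(R) + I_{Rm}(R) + ε < U(s) + I_{Rm}(s)`, the fields `I_{Rm}` summed over `(y ∩ B̄(y_j, Rm)) ∖ s` only;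
  `exchangeUnstable_of_loc : ϱ + D ≤ Rm → 7/10 ≤ D → ExchangeUnstableLoc (ε + 2K·T(D)) ϱ Rm K y j → ExchangeUnstable ε ϱ K y j`;
  `deepAbsent_exchangeUnstableLoc`; BY NAME `aperiodicFrustratedLawGap_of_schurCut_exchangeLoc_fourHalf` (unsplit node of record) — the
  refund set `{GoodAt(1/20) ∨ ExchangeUnstableLoc …}` is decidable from the `max(Rm, 13/10·nn + …)`-neighbourhood of the site.
All `[folklore]` bookkeeping on landed lemmas.
-/

noncomputable section

namespace Summit.AtomisticToContinuum.Crystallization.Theorems.FrustratedLawDichotomyExemptLocal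

open Metric
open Literature.MathematicalPhysics.StatisticalMechanics
open Summit.AtomisticToContinuum.Crystallization.Theorems.ChargedEnergyGapNegative (E3 eStar)
open Summit.AtomisticToContinuum.Crystallization.Theorems.FrustratedLawDichotomyExemptDoor
open Summit.AtomisticToContinuum.Crystallization.Theorems.FrustratedLawDichotomyExemptRemoval
  (tailConst tailConst_nonneg SchurRangeGapX aperiodicFrustratedLawGap_of_schurCutX_fourHalf)
open Summit.AtomisticToContinuum.Crystallization.Theorems.FrustratedLawDichotomyExemptLocOpt
  (ExchangeUnstable locOptDepth deepAbsent_exchangeUnstable tsum_sdiff_split abs_fieldEnergy_far_le)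
open Summit.AtomisticToContinuum.Crystallization.Theorems.FrustratedLawDichotomyRangeCut (Sep GoodAt PeriodicEnergyCeiling)
open Summit.AtomisticToContinuum.Crystallization.Theorems.FrustratedLawDichotomySchurCut (w₄₅ ω₄ SF₄₅)

/-! ## §1. The motif-local exchange test -/

/-- **MOTIF-LOCAL `K`-EXCHANGE INSTABILITY**: `y` is `7/10`-separated and some sub-configuration `s` (`#s ≤ K`) of `y` inside `B̄(y_j, ϱ)` and
some injective competitor `R` of the same size inside `B̄(y_j, ϱ)` avoiding `y ∖ s` satisfy `U(R) + I_{Rm}(R) + ε < U(s) + I_{Rm}(s)`, where the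
fields `I_{Rm}` are summed over the atoms of `y` WITHIN `Rm` OF `y_j` (and off `s`) only. -/
def ExchangeUnstableLoc (ε ϱ Rm : ℝ) (K : ℕ) : SitePred := fun _ y j =>
  Sep y ∧ ∃ (a : ℕ) (s R : Fin a → EuclideanSpace ℝ (Fin 3)), a ≤ K ∧ Function.Injective s ∧ Set.range s ⊆ Set.range y ∧
    (∀ l, dist (s l) (y j) ≤ ϱ) ∧ Function.Injective R ∧ (∀ l, dist (R l) (y j) ≤ ϱ) ∧
    Disjoint (Set.range R) (Set.range y \ Set.range s) ∧
      interactionEnergy lennardJones R +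
          (∑ i, ∑' q : ↥((Set.range y ∩ closedBall (y j) Rm) \ Set.range s), lennardJones (dist (R i) q)) + ε <
        interactionEnergy lennardJones s +
          (∑ i, ∑' q : ↥((Set.range y ∩ closedBall (y j) Rm) \ Set.range s), lennardJones (dist (s i) q))

/-- Fields over the (finite) range of a cluster are summable. [folklore] -/
theorem summable_range {N : ℕ} (y : Fin N → EuclideanSpace ℝ (Fin 3)) (r : EuclideanSpace ℝ (Fin 3)) :
    Summable fun q : ↥(Set.range y) => lennardJones (dist r q) := by
  haveI : Finite ↥(Set.range y) := (Set.finite_range y).to_subtype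
  exact Summable.of_finite

/-- A `7/10`-separated cluster has a `7/10`-separated range (as a set). [folklore] -/
theorem sep_range {N : ℕ} {y : Fin N → EuclideanSpace ℝ (Fin 3)} (hsep : Sep y) :
    ∀ a ∈ Set.range y, ∀ b ∈ Set.range y, a ≠ b → (7 : ℝ) / 10 ≤ dist a b := by
  rintro _ ⟨i, rfl⟩ _ ⟨k, rfl⟩ hne
  exact hsep i k fun h => hne (by rw [h])

/-- ★ **The local test implies the cluster-level exemption**: for `Rm ≥ ϱ + D`, `D ≥ 7/10`,
`ExchangeUnstableLoc (ε + 2K·T(D)) ϱ Rm K ⟹ ExchangeUnstable ε ϱ K` — the atoms of `y` beyond `Rm` from `y_j` are farther than `D` from the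
ball and change each of the two fields by at most `K·T(D)`. [folklore] -/
theorem exchangeUnstable_of_loc {ε ϱ Rm D : ℝ} {K : ℕ} (hRm : ϱ + D ≤ Rm) (hD : (7 : ℝ) / 10 ≤ D)
    {N : ℕ} {y : Fin N → EuclideanSpace ℝ (Fin 3)} {j : Fin N}
    (h : ExchangeUnstableLoc (ε + 2 * K * tailConst D) ϱ Rm K N y j) : ExchangeUnstable ε ϱ K N y j := by
  obtain ⟨hsep, a, s, R, haK, hs, hsY, hsball, hR, hRball, hdisj, hlt⟩ := h
  refine ⟨a, s, R, haK, hs, hsY, hsball, hR, hRball, hdisj, ?_⟩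
  -- split both cluster fields at the motif `A = range y ∩ B̄(y j, Rm)`
  have hAX : Set.range y ∩ closedBall (y j) Rm ⊆ Set.range y := Set.inter_subset_left
  have hD0 : 0 ≤ D := le_trans (by norm_num) hD
  have hSA : Set.range s ⊆ Set.range y ∩ closedBall (y j) Rm := fun q hq => by
    obtain ⟨l, rfl⟩ := hq
    exact ⟨hsY ⟨l, rfl⟩, mem_closedBall.2 (by linarith [hsball l])⟩
  have hsplit : ∀ (x : Fin a → EuclideanSpace ℝ (Fin 3)),
      (∑ i, ∑' q : ↥(Set.range y \ Set.range s), lennardJones (dist (x i) q)) =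
        (∑ i, ∑' q : ↥((Set.range y ∩ closedBall (y j) Rm) \ Set.range s), lennardJones (dist (x i) q)) +
          ∑ i, ∑' q : ↥(Set.range y \ (Set.range y ∩ closedBall (y j) Rm)), lennardJones (dist (x i) q) := by
    intro x
    rw [← Finset.sum_add_distrib]
    exact Finset.sum_congr rfl fun i _ => tsum_sdiff_split (summable_range y) hAX hSA (x i)
  -- the far atoms are `7/10`-separated and farther than `D` from every point of the ball
  have hsepF : ∀ p ∈ Set.range y \ (Set.range y ∩ closedBall (y j) Rm),
      ∀ q ∈ Set.range y \ (Set.range y ∩ closedBall (y j) Rm), p ≠ q → (7 : ℝ) / 10 ≤ dist p q :=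
    fun p hp q hq hpq => sep_range hsep p hp.1 q hq.1 hpq
  have hfar : ∀ z : EuclideanSpace ℝ (Fin 3), dist z (y j) ≤ ϱ →
      ∀ q ∈ Set.range y \ (Set.range y ∩ closedBall (y j) Rm), D ≤ dist z q := by
    intro z hz q hq
    have hqR : Rm < dist q (y j) := by
      by_contra hle
      rw [not_lt] at hle
      exact hq.2 ⟨hq.1, mem_closedBall.2 hle⟩
    have htri : dist q (y j) ≤ dist z q + dist z (y j) := by
      rw [dist_comm z q]; exact dist_triangle q z (y j)
    linarith
  have hfs := abs_fieldEnergy_far_le hsepF hD s fun i q hq => hfar (s i) (hsball i) q hq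
  have hfR := abs_fieldEnergy_far_le hsepF hD R fun i q hq => hfar (R i) (hRball i) q hq
  have hfs' := neg_abs_le (∑ i, ∑' q : ↥(Set.range y \ (Set.range y ∩ closedBall (y j) Rm)), lennardJones (dist (s i) q))
  have hfR' := le_abs_self (∑ i, ∑' q : ↥(Set.range y \ (Set.range y ∩ closedBall (y j) Rm)), lennardJones (dist (R i) q))
  have ha : (a : ℝ) ≤ K := by exact_mod_cast haK
  have hT0 : 0 ≤ tailConst D := tailConst_nonneg hD0
  have haT : (a : ℝ) * tailConst D ≤ K * tailConst D := mul_le_mul_of_nonneg_right ha hT0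
  rw [hsplit R, hsplit s]
  linarith

/-- **The motif-local exchange exemption is deep-absent** (at the depth of `…ExemptLocOpt.locOptDepth ε ϱ K`). [folklore] -/
theorem deepAbsent_exchangeUnstableLoc {ε ϱ Rm D : ℝ} {K : ℕ} (hε : 0 < ε) (hRm : ϱ + D ≤ Rm) (hD : (7 : ℝ) / 10 ≤ D) :
    DeepAbsent (locOptDepth ε ϱ K) (ExchangeUnstableLoc (ε + 2 * K * tailConst D) ϱ Rm K) :=
  (deepAbsent_exchangeUnstable hε).of_imp fun _ _ _ h => exchangeUnstable_of_loc hRm hD h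

/-! ## §2. The crux BY NAME from a motif-local exempt price -/

/-- **`AperiodicFrustratedLawGap` BY NAME** from an exempt price whose refund set is read off the `Rm`-motif of each site:
`MuEquilibriumDoor ∧ ExemptFDG (ExchangeUnstableLoc (ε + 2K·T(D)) ϱ Rm K)` (`ε > 0`, `D ≥ 7/10`, `Rm ≥ ϱ + D`) `⟹` crux. [folklore] -/
theorem aperiodicFrustratedLawGap_of_exchangeLocExempt
    (hDoor : Summit.AtomisticToContinuum.Crystallization.Theses.GrainCoreNetworkSplit.MuEquilibriumDoor)
    {ε ϱ Rm D : ℝ} {K : ℕ} (hε : 0 < ε) (hRm : ϱ + D ≤ Rm) (hD : (7 : ℝ) / 10 ≤ D)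
    (h : ExemptFDG (ExchangeUnstableLoc (ε + 2 * K * tailConst D) ϱ Rm K)) :
    Summit.AtomisticToContinuum.Crystallization.Theses.FrustratedLawDichotomy.AperiodicFrustratedLawGap :=
  aperiodicFrustratedLawGap_of_exemptFDG hDoor (deepAbsent_exchangeUnstableLoc hε hRm hD) h

/-- **Unsplit node of record with the motif-local exchange exemption**: `MuEquilibriumDoor ∧ SF₄₅ ∧ UP(−0.7175) ∧
FRG♭_X(w₄₅, ω₄, 3/400; −0.7174, C, ExchangeUnstableLoc (ε + 2K·T(D)) ϱ Rm K) ⟹` crux (`ε > 0`, `D ≥ 7/10`, `Rm ≥ ϱ + D`). [folklore] -/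
theorem aperiodicFrustratedLawGap_of_schurCut_exchangeLoc_fourHalf {ε ϱ Rm D C : ℝ} {K : ℕ}
    (hDoor : Summit.AtomisticToContinuum.Crystallization.Theses.GrainCoreNetworkSplit.MuEquilibriumDoor)
    (hF : SF₄₅) (hU : PeriodicEnergyCeiling (-(7175 / 10000))) (hε : 0 < ε) (hRm : ϱ + D ≤ Rm) (hD : (7 : ℝ) / 10 ≤ D)
    (hG : SchurRangeGapX w₄₅ ω₄ (3 / 400) (-(7174 / 10000)) C (ExchangeUnstableLoc (ε + 2 * K * tailConst D) ϱ Rm K)) :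
    Summit.AtomisticToContinuum.Crystallization.Theses.FrustratedLawDichotomy.AperiodicFrustratedLawGap :=
  aperiodicFrustratedLawGap_of_schurCutX_fourHalf hDoor hF hU (deepAbsent_exchangeUnstableLoc hε hRm hD) hG (by norm_num)

end Summit.AtomisticToContinuum.Crystallization.Theorems.FrustratedLawDichotomyExemptLocal

end
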